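import Summits.Ventures.Crystal3D.Theorems.StickyWulffConstantGenericWallFloorBarlowOrientedGlue
import Summits.Ventures.Crystal3D.Theorems.StickyWulffConstantGenericWallFloorBarlowReversal
import Summits.Ventures.Crystal3D.Theorems.StickyWulffConstantTextureLiminfTexShadowCoverableDefs
import HarnessLib

/-!
# F4, final G-side form: the line count of lane T's `hlines` for every COVERABLE pair (`BarlowOffReach ∧ DeltaSteep₁ ∧ DeltaSteep₂`),
# any orientation (crux `GenericWallFloor`, stmt-Ventures-19480, line `WallLedgerG`; lane T's covered glue v2, cf-p1 (xxxvii)/(xxxix))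

HONEST FRAMING. Venture `Summits/Ventures/Crystal3D` (cell `crystal3d-full`), helper `--supports` the crux `GenericWallFloor`
(stmt-Ventures-19480) of `route-Ventures-StickyWulffConstant`, registered line `WallLedgerG`, open stub `stub_twoSlabAdhesion`.
Rung credit only; F-C1 not moved; NOT the stub.  Inputs BY NAME: E1 (`ExactOnly`, from `P5Exhaustion`), `DoubleStarCoaxialAt` /
`CapPairCoaxial` (from `StarPairFar`).

`barlow_hlines_oriented` (`…BarlowOrientedGlue`) is the count for UP-PRESENTED pairs.  Here each plate is replaced by its
up-presentation (`upFrame`, `upWord` of `…TexShadowCoverableDefs`; same plate: `stacking_upFrame`), the oriented count is applied, and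
the selectors / window polylines are transported back to the ORIGINAL `(Lᵢ, σᵢ)` indexing (`isZigSelector_reverse`,
`moved_vertex_reverse` of `…BarlowReversal`).  Result:

* `exists_upPresentation` — per plate: an up-presented `(L*, σ*)` of the same stacking with `upFrame = L*`, `upWord = σ*`, and a
  transport of selectors `step*` of `(L*, σ*)` to selectors `step` of `(L, σ)` with identical moved polylines;
* **`barlow_hlines_coverable`** — for `R₀ ≥ 6`, with `C_w = 318 + 192·R₀`: for all Hägg `σ₁ σ₂` and all `L₁ L₂ s₁ s₂` with
  `BarlowOffReach L₁ s₁ σ₁ L₂ s₂ σ₂`, `DeltaSteep L₁ e₃`, `DeltaSteep L₂ (−e₃)`: `∃ step₁ step₂, IsZigSelector L₁ σ₁ e₃ step₁ ∧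
  IsZigSelector L₂ σ₂ (−e₃) step₂ ∧ ∀ cell (six hypotheses of BilayerWallAt verbatim), ∃ m ≥ 0, T₁ T₂ ⊇ window lines at lateral ρ − m,
  #T₁ + #T₂ + 18·m·ρ ≤ Σ_PAY(12 − deg) + C_w(1+h)ρ` — i.e. lane T's `hlines` conditioned on coverability, modulo E1 and StarPairFar.
WHAT THIS IS NOT: not the stub; lane T's restated CoveredGlue consumes it; F-C1 not moved.
-/

noncomputable section

namespace Summit.Ventures.Crystal3D.Theorems

open Finset
open Literature.MathematicalPhysics.StatisticalMechanics (barlowPos barlowStacking basalMirror haggLabel barlowOffset IsHaggSeq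
  triangularVec₁ triangularVec₂)
open Summit.Ventures.Crystal3D.Cruxes.TextureLiminf.TexShadow (stacking cyl upSlot₁ upSlot₂ upSlot₃ bilayerRise upFrame upWord famSlot
  DeltaSteep BarlowOffReach stacking_upFrame upFrame_axis_nonneg isHaggSeq_upWord famSlot_steep_of_deltaSteep)
open scoped InnerProductSpace

/-- **The up-presentation package of a plate** toward `e`: `L* = upFrame L e`, `σ* = upWord L σ e` (Hägg, axis along `e`, same stacking),
and every selector of `(L*, σ*)` transports to a selector of `(L, σ)` with the same moved polyline points. -/
theorem exists_upPresentation (L : EuclideanSpace ℝ (Fin 3) ≃ₗᵢ[ℝ] EuclideanSpace ℝ (Fin 3)) {σ : ℤ → ℤ} (hσ : IsHaggSeq σ)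
    (s e : EuclideanSpace ℝ (Fin 3)) :
    IsHaggSeq (upWord L σ e) ∧ 0 ≤ ((upFrame L e).symm e) 2 ∧ stacking (upFrame L e) s (upWord L σ e) = stacking L s σ ∧
    ∀ step' : ℤ → EuclideanSpace ℝ (Fin 3), IsZigSelector (upFrame L e) (upWord L σ e) e step' →
      ∃ step : ℤ → EuclideanSpace ℝ (Fin 3), IsZigSelector L σ e step ∧
        ∀ (k : ℤ) (t : Fin 2 → ℤ),
          L (zigVertexS step k + ((t 0 : ℝ) • triangularVec₁ 1 + (t 1 : ℝ) • triangularVec₂ 1)) + s =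
            upFrame L e (zigVertexS step' k + ((t 0 : ℝ) • triangularVec₁ 1 + (t 1 : ℝ) • triangularVec₂ 1)) + s := by
  refine ⟨isHaggSeq_upWord L hσ e, upFrame_axis_nonneg L e, stacking_upFrame L s σ e, fun step' hsel' => ?_⟩
  by_cases hax : 0 ≤ (L.symm e) 2
  · have hF : upFrame L e = L := by unfold upFrame; rw [if_pos hax]
    have hW : upWord L σ e = σ := by unfold upWord; rw [if_pos hax]
    rw [hF, hW] at hsel'
    exact ⟨step', hsel', fun k t => by rw [hF]⟩
  · have hneg : (L.symm e) 2 < 0 := not_le.1 hax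
    have hF : upFrame L e = basalMirror.trans L := by unfold upFrame; rw [if_neg hax]
    have hW : upWord L σ e = fun n => -σ (-n - 1) := by unfold upWord; rw [if_neg hax]
    rw [hF, hW] at hsel'
    refine ⟨fun k => basalMirror (step' k), isZigSelector_reverse L hσ e hneg hsel', fun k t => ?_⟩
    rw [hF, moved_vertex_reverse]

/-- **Lane T's `hlines` for coverable pairs, any orientation.**  See the module docstring. -/
theorem barlow_hlines_coverable
    {sE : EuclideanSpace ℝ (Fin 3)} (hsE : sE ∈ fccSlots) (hcert : ExactOnly 0 (fccSlots.filter fun w => 0 < ⟪w, sE⟫_ℝ))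
    (hDS : ∀ F₁ F₂ : EuclideanSpace ℝ (Fin 3) ≃ₗᵢ[ℝ] EuclideanSpace ℝ (Fin 3), DoubleStarCoaxialAt F₁ F₂) (hCP : CapPairCoaxial)
    (R₀ : ℝ) (hR₀ : 6 ≤ R₀) {σ₁ σ₂ : ℤ → ℤ} (hσ₁ : IsHaggSeq σ₁) (hσ₂ : IsHaggSeq σ₂)
    (L₁ L₂ : EuclideanSpace ℝ (Fin 3) ≃ₗᵢ[ℝ] EuclideanSpace ℝ (Fin 3)) (s₁ s₂ : EuclideanSpace ℝ (Fin 3))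
    (hoff : BarlowOffReach L₁ s₁ σ₁ L₂ s₂ σ₂)
    (hΔ₁ : DeltaSteep L₁ (EuclideanSpace.single (2 : Fin 3) (1 : ℝ)))
    (hΔ₂ : DeltaSteep L₂ (-EuclideanSpace.single (2 : Fin 3) (1 : ℝ))) :
    ∃ step₁ step₂ : ℤ → EuclideanSpace ℝ (Fin 3),
      IsZigSelector L₁ σ₁ (EuclideanSpace.single (2 : Fin 3) (1 : ℝ)) step₁ ∧
      IsZigSelector L₂ σ₂ (-EuclideanSpace.single (2 : Fin 3) (1 : ℝ)) step₂ ∧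
      ∀ h : ℝ, 0 ≤ h → ∀ ρ : ℝ, R₀ ≤ ρ → ∀ X P₁ P₂ : Finset (EuclideanSpace ℝ (Fin 3)),
      (∀ p ∈ X, ∀ q ∈ X, p ≠ q → 1 ≤ dist p q) → P₁ ⊆ X → P₂ ⊆ X \ P₁ → (∀ p ∈ X, p ∈ cyl R₀ h ρ) →
      (∀ p, p ∈ P₁ ↔ (p ∈ stacking L₁ s₁ σ₁ ∧ -(2 * R₀) ≤ p 2 ∧ p 2 ≤ -R₀ ∧ p 0 ^ 2 + p 1 ^ 2 ≤ ρ ^ 2)) →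
      (∀ p, p ∈ P₂ ↔ (p ∈ stacking L₂ s₂ σ₂ ∧ h + R₀ ≤ p 2 ∧ p 2 ≤ h + 2 * R₀ ∧ p 0 ^ 2 + p 1 ^ 2 ≤ ρ ^ 2)) →
      ∃ (m : ℝ) (T₁ T₂ : Finset (Fin 2 → ℤ)), 0 ≤ m ∧
        (∀ t : Fin 2 → ℤ, (∃ k : ℤ,
          -R₀ - 4 ≤ (L₁ (zigVertexS step₁ k + ((t 0 : ℝ) • triangularVec₁ 1 + (t 1 : ℝ) • triangularVec₂ 1)) + s₁) 2 ∧
          (L₁ (zigVertexS step₁ k + ((t 0 : ℝ) • triangularVec₁ 1 + (t 1 : ℝ) • triangularVec₂ 1)) + s₁) 2 ≤ -R₀ - 3 ∧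
          Real.sqrt ((L₁ (zigVertexS step₁ k + ((t 0 : ℝ) • triangularVec₁ 1 + (t 1 : ℝ) • triangularVec₂ 1)) + s₁) 0 ^ 2 +
            (L₁ (zigVertexS step₁ k + ((t 0 : ℝ) • triangularVec₁ 1 + (t 1 : ℝ) • triangularVec₂ 1)) + s₁) 1 ^ 2) ≤ ρ - m) →
          t ∈ T₁) ∧
        (∀ t : Fin 2 → ℤ, (∃ k : ℤ,
          h + R₀ + 3 ≤ (L₂ (zigVertexS step₂ k + ((t 0 : ℝ) • triangularVec₁ 1 + (t 1 : ℝ) • triangularVec₂ 1)) + s₂) 2 ∧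
          (L₂ (zigVertexS step₂ k + ((t 0 : ℝ) • triangularVec₁ 1 + (t 1 : ℝ) • triangularVec₂ 1)) + s₂) 2 ≤ h + R₀ + 4 ∧
          Real.sqrt ((L₂ (zigVertexS step₂ k + ((t 0 : ℝ) • triangularVec₁ 1 + (t 1 : ℝ) • triangularVec₂ 1)) + s₂) 0 ^ 2 +
            (L₂ (zigVertexS step₂ k + ((t 0 : ℝ) • triangularVec₁ 1 + (t 1 : ℝ) • triangularVec₂ 1)) + s₂) 1 ^ 2) ≤ ρ - m) →
          t ∈ T₂) ∧
        (T₁.card : ℝ) + T₂.card + 18 * m * ρ ≤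
          (∑ y ∈ X.filter (fun y => (X.filter fun q => dist y q = 1).card ≠ 12 ∧ -R₀ - 2 ≤ y 2 ∧ y 2 ≤ h + R₀ + 2),
            ((12 : ℝ) - ((X.filter fun q => dist y q = 1).card : ℝ))) + (318 + 192 * R₀) * (1 + h) * ρ := by
  set e₃ : EuclideanSpace ℝ (Fin 3) := EuclideanSpace.single (2 : Fin 3) (1 : ℝ) with he₃
  -- the two up-presentations
  obtain ⟨hσ₁', hax₁, hst₁, htr₁⟩ := exists_upPresentation L₁ hσ₁ s₁ e₃
  obtain ⟨hσ₂', hax₂, hst₂, htr₂⟩ := exists_upPresentation L₂ hσ₂ s₂ (-e₃)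
  set L₁' := upFrame L₁ e₃ with hL₁'
  set L₂' := upFrame L₂ (-e₃) with hL₂'
  set σ₁' := upWord L₁ σ₁ e₃ with hσ₁'def
  set σ₂' := upWord L₂ σ₂ (-e₃) with hσ₂'def
  -- steepness of the family slots
  have hst1 := famSlot_steep_of_deltaSteep L₁ e₃ hΔ₁
  have hst2 := famSlot_steep_of_deltaSteep L₂ (-e₃) hΔ₂
  have hfam₁ : famSlot L₁ e₃ = best3 (fun w => ⟪w, L₁'.symm e₃⟫_ℝ) upSlot₁ upSlot₂ upSlot₃ := rfl
  have hfam₂ : famSlot L₂ (-e₃) = best3 (fun w => ⟪w, L₂'.symm (-e₃)⟫_ℝ) upSlot₁ upSlot₂ upSlot₃ := rfl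
  rw [hfam₁] at hst1
  rw [hfam₂] at hst2
  -- off-reach in the presented form
  have he₃' : Summit.Ventures.Crystal3D.Cruxes.TextureLiminf.TexShadow.e₃ = e₃ := rfl
  obtain ⟨hO1, hO2, hO3⟩ := hoff
  rw [he₃'] at hO1 hO2 hO3
  rw [hfam₁] at hO1 hO3
  rw [hfam₂] at hO2 hO3
  -- the oriented count for the presented pair
  obtain ⟨step₁', step₂', hsel₁', hsel₂', hmain⟩ := barlow_hlines_oriented hsE hcert hDS hCP hσ₁' hσ₂' L₁' L₂' s₁ s₂ hax₁ hax₂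
    hst1 hst2 (fun y hy => by rw [hst₂]; exact hO1 y hy) (fun y hy => by rw [hst₁]; exact hO2 y hy) hO3 R₀ hR₀
  -- transport the selectors
  obtain ⟨step₁, hsel₁, hpt₁⟩ := htr₁ step₁' hsel₁'
  obtain ⟨step₂, hsel₂, hpt₂⟩ := htr₂ step₂' hsel₂'
  refine ⟨step₁, step₂, hsel₁, hsel₂, ?_⟩
  intro h hh ρ hρ X P₁ P₂ hX hP₁X hP₂X hcyl hP₁ hP₂
  have hP₁' : ∀ p, p ∈ P₁ ↔ (p ∈ stacking L₁' s₁ σ₁' ∧ -(2 * R₀) ≤ p 2 ∧ p 2 ≤ -R₀ ∧ p 0 ^ 2 + p 1 ^ 2 ≤ ρ ^ 2) := by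
    intro p; rw [hst₁]; exact hP₁ p
  have hP₂' : ∀ p, p ∈ P₂ ↔ (p ∈ stacking L₂' s₂ σ₂' ∧ h + R₀ ≤ p 2 ∧ p 2 ≤ h + 2 * R₀ ∧ p 0 ^ 2 + p 1 ^ 2 ≤ ρ ^ 2) := by
    intro p; rw [hst₂]; exact hP₂ p
  obtain ⟨m, T₁, T₂, hm0, hT₁, hT₂, hcount⟩ := hmain h hh ρ hρ X P₁ P₂ hX hP₁X hP₂X hcyl hP₁' hP₂'
  refine ⟨m, T₁, T₂, hm0, fun t ⟨k, hk⟩ => hT₁ t ⟨k, ?_⟩, fun t ⟨k, hk⟩ => hT₂ t ⟨k, ?_⟩, hcount⟩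
  · rw [← hpt₁ k t]; exact hk
  · rw [← hpt₂ k t]; exact hk

end Summit.Ventures.Crystal3D.Theorems

end
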